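import Summits.ResolutionOfSingularities.ResolutionOfSingularities.Theorems.FrobeniusLadderFRationalResolutionBlowupRegularFlatChartAway
import Literature.AlgebraicGeometry.Resolution.Hironaka2005CompletionRegular
import Literature.AlgebraicGeometry.Resolution.ArtinApproximationAffineLemmas
import Literature.AlgebraicGeometry.Resolution.WeakJacobianMizutaniProof
import HarnessLib

/-!
# Crux `FrobeniusLadder.FRationalResolution` (stmt-ResolutionOfSingularities-15317), line `redirect`,
# stub `stub_diagonalizableQuotientResolution` — regularity of a blow-up ASCENDS along a regular homomorphism, in particular to the adic
# completion of a G-ring: `Bl_I` regular near `𝔮` ⟺ `Bl_{IÊ}(Spec Ê)` regular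

Converse of this generation's `…BlowupRegularFlatChart` (descent along the faithfully flat `B_𝔮 → Ê`): for the interface
`…GaloisCharacteristicCentre.hloc_of_characteristic_ideal_adicCompletion` the successor must produce `Bl_J(Spec Ê)` REGULAR from the
regularity of a blow-up computed on the (toric) chart, i.e. transport regularity UP to the completion. This is EGA IV₂ 6.8.3 / Matsumura
23.7 (ii) along the regular homomorphism `B_𝔮 → Ê` (G-ring), available in the tree as `isRegular_pullback_of_isRegularHom`
(`Literature/…/Hironaka2005CompletionRegular`) + `IsGRing.isRegularHom_completion_of_isLocalization_atPrime` + the theorem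
`Matsumura1987_32_6_cor_holds` (finite type algebras over a field are G-rings):

* `isRegular_affineBlowup_map_of_isRegularHom` — `D → E` regular homomorphism of Noetherian rings: `Bl_I(Spec D)` regular ⇒
  `Bl_{IE}(Spec E)` regular (blow-ups commute with flat base change);
* `isRegular_affineBlowup_adicCompletion_of_isGRing` — `B` a G-ring, `𝔮` prime: `Bl_{I B_𝔮}` regular ⇒ `Bl_{I Ê}` regular, `Ê = (B_𝔮)^`;
* `isRegular_affineBlowup_adicCompletion_of_isRegular` — the same from `Bl_I(Spec B)` regular (`B → B_𝔮 → Ê` regular);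
* **`isRegular_affineBlowup_adicCompletion_iff`** — `B` of finite type over a field, `𝔮` maximal, `𝔮ⁿ ⊆ I ⊆ 𝔮`, `Spec B ∖ {𝔮}` regular:
  `Bl_I(Spec B)` regular ⟺ `Bl_{IÊ}(Spec Ê)` regular.

Honest label: generic scheme plumbing toward ONE leaf stub (no stub, crux or summit closed). No definitions, no named facts, no sorry.
[cite: Grothendieck1965, (6.8.3)] [cite: Matsumura1987, Thm. 23.7 (ii); §32, Cor. of Thm. 32.6] [cite: GortzWedhorn2020, Prop. 13.91 (2)]
-/

noncomputable section

-- single-problem summit: the doubled namespace component is forced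
set_option linter.dupNamespace false

open CategoryTheory CategoryTheory.Limits AlgebraicGeometry
open Literature.AlgebraicGeometry.Resolution
open Summit.ResolutionOfSingularities.ResolutionOfSingularities.Theorems.FRationalResolution

namespace Summit.ResolutionOfSingularities.ResolutionOfSingularities.Theorems.FRationalResolution.BlowupRegularCompletionAscent

/-- **Regularity of `Bl_I(Spec D)` ascends along a regular homomorphism `D → E`** (Noetherian rings): `Bl_{IE}(Spec E) ≅
Bl_I(Spec D) ×_D E` is regular by EGA IV₂ 6.8.3 (tree `isRegular_pullback_of_isRegularHom`). [cite: Grothendieck1965, (6.8.3)]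
[cite: Matsumura1987, Thm. 23.7 (ii)] [cite: GortzWedhorn2020, Prop. 13.91 (2)] -/
theorem isRegular_affineBlowup_map_of_isRegularHom {D E : Type} [CommRing D] [CommRing E] [Algebra D E]
    [IsNoetherianRing D] [IsNoetherianRing E] (h : IsRegularHom D E) (I : Ideal D)
    (hreg : Scheme.IsRegular (affineBlowup I)) :
    Scheme.IsRegular (affineBlowup (I.map (algebraMap D E))) := by
  haveI : Module.Flat D E := h.flat
  haveI : Flat (specOfAlgebra D E) := BlowupRegularFlatChart.flat_specMap_algebraMap D E
  -- the base change of `Bl_I(Spec D)` along `Spec E → Spec D` is a blow-up of `Spec E` along `(IE)~`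
  have hbc : IsBlowup (pullback.snd (affineBlowup.π I) (specOfAlgebra D E)) (affineBlowup.idealSheaf (I.map (algebraMap D E))) := by
    rw [← BlowupFlatCriteria.idealSheaf_comap_specMap]
    exact (affineBlowup.isBlowup I).pullback_snd_of_flat (specOfAlgebra D E)
  obtain ⟨e, -, -⟩ := hbc.unique (affineBlowup.isBlowup (I.map (algebraMap D E)))
  exact Scheme.IsRegular.of_iso e.hom (isRegular_pullback_of_isRegularHom E h (affineBlowup.π I) hreg)

/-- **Ascent to the completion of a G-ring**: `B` a G-ring, `𝔮` a prime, `Ê = (B_𝔮)^`; if `Bl_{I B_𝔮}(Spec B_𝔮)` is regular then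
`Bl_{I Ê}(Spec Ê)` is regular (`B_𝔮 → Ê` is a regular homomorphism). [cite: Matsumura1987, §32 p. 256; Thm. 23.7 (ii)] -/
theorem isRegular_affineBlowup_adicCompletion_of_isGRing {B : Type} [CommRing B] (hB : IsGRing B) (𝔮 : Ideal B) [𝔮.IsPrime]
    (I : Ideal B) (hreg : Scheme.IsRegular (affineBlowup (I.map (algebraMap B (Localization.AtPrime 𝔮))))) :
    Scheme.IsRegular (affineBlowup ((I.map (algebraMap B (Localization.AtPrime 𝔮))).map
      (algebraMap (Localization.AtPrime 𝔮)
        (AdicCompletion (IsLocalRing.maximalIdeal (Localization.AtPrime 𝔮)) (Localization.AtPrime 𝔮))))) := by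
  haveI : IsNoetherianRing B := hB.1
  haveI : IsNoetherianRing (Localization.AtPrime 𝔮) :=
    IsLocalization.isNoetherianRing 𝔮.primeCompl (Localization.AtPrime 𝔮) inferInstance
  haveI : IsNoetherianRing (AdicCompletion (IsLocalRing.maximalIdeal (Localization.AtPrime 𝔮)) (Localization.AtPrime 𝔮)) :=
    isNoetherianRing_adicCompletion_maximalIdeal _
  exact isRegular_affineBlowup_map_of_isRegularHom
    (IsGRing.isRegularHom_completion_of_isLocalization_atPrime hB 𝔮 (Localization.AtPrime 𝔮)) _ hreg

/-- **From `Bl_I(Spec B)` regular to `Bl_{IÊ}(Spec Ê)` regular** (`B` a G-ring): `B → B_𝔮 → Ê` is a regular homomorphism (tree `IsGRing.isRegularHom_comp_completion`).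
[cite: Matsumura1987, §32 p. 256; Thm. 23.7 (ii)] [cite: GortzWedhorn2020, Prop. 13.91 (2)] -/
theorem isRegular_affineBlowup_adicCompletion_of_isRegular {B : Type} [CommRing B] (hB : IsGRing B) (𝔮 : Ideal B) [𝔮.IsPrime]
    (I : Ideal B) (hreg : Scheme.IsRegular (affineBlowup I)) :
    Scheme.IsRegular (affineBlowup ((I.map (algebraMap B (Localization.AtPrime 𝔮))).map
      (algebraMap (Localization.AtPrime 𝔮)
        (AdicCompletion (IsLocalRing.maximalIdeal (Localization.AtPrime 𝔮)) (Localization.AtPrime 𝔮))))) := by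
  haveI : IsNoetherianRing B := hB.1
  haveI : IsNoetherianRing (Localization.AtPrime 𝔮) :=
    IsLocalization.isNoetherianRing 𝔮.primeCompl (Localization.AtPrime 𝔮) inferInstance
  haveI : IsNoetherianRing (AdicCompletion (IsLocalRing.maximalIdeal (Localization.AtPrime 𝔮)) (Localization.AtPrime 𝔮)) :=
    isNoetherianRing_adicCompletion_maximalIdeal _
  -- `B → B_𝔮 → Ê` is a regular homomorphism (localization, then the G-ring property)
  have h := isRegular_affineBlowup_map_of_isRegularHom
    (IsGRing.isRegularHom_comp_completion hB 𝔮 (Localization.AtPrime 𝔮)) I hreg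
  have hfac : algebraMap B (AdicCompletion (IsLocalRing.maximalIdeal (Localization.AtPrime 𝔮)) (Localization.AtPrime 𝔮)) =
      (algebraMap (Localization.AtPrime 𝔮) _).comp (algebraMap B (Localization.AtPrime 𝔮)) :=
    RingHom.ext fun _ => rfl
  rwa [hfac, ← Ideal.map_map] at h

/-- **`Bl_I` regular ⟺ `Bl_{IÊ}` regular** for `B` of finite type over a field `K` (a G-ring, Matsumura Cor. of Thm. 32.6 — tree theorem
`Matsumura1987_32_6_cor_holds`), `𝔮` maximal, `𝔮ⁿ ⊆ I ⊆ 𝔮` and `Spec B ∖ {𝔮}` regular: «⇐» is this generation's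
`…BlowupRegularFlatChart.isRegular_affineBlowup_of_adicCompletion_atPrime` (faithfully flat descent), «⇒» the ascent above.
[cite: Matsumura1987, §32, Cor. of Thm. 32.6; Thm. 23.7] [cite: GortzWedhorn2020, Prop. 13.91 (2)] -/
theorem isRegular_affineBlowup_adicCompletion_iff (K : Type) [Field K] {B : Type} [CommRing B] [Algebra K B] [Algebra.FiniteType K B]
    (𝔮 : Ideal B) [h𝔮 : 𝔮.IsMaximal] (I : Ideal B) {n : ℕ} (hI : 𝔮 ^ n ≤ I) (hI𝔮 : I ≤ 𝔮)
    (hoff : ∀ x : Spec (.of B), x.asIdeal ≠ 𝔮 → x ∈ Scheme.regularLocus (Spec (.of B))) :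
    Scheme.IsRegular (affineBlowup I) ↔
      Scheme.IsRegular (affineBlowup ((I.map (algebraMap B (Localization.AtPrime 𝔮))).map
        (algebraMap (Localization.AtPrime 𝔮)
          (AdicCompletion (IsLocalRing.maximalIdeal (Localization.AtPrime 𝔮)) (Localization.AtPrime 𝔮))))) := by
  have hB : IsGRing B := Matsumura1987_32_6_cor_holds.{0} K B ‹_›
  haveI : IsNoetherianRing B := hB.1
  exact ⟨isRegular_affineBlowup_adicCompletion_of_isRegular hB 𝔮 I,
    BlowupRegularFlatChart.isRegular_affineBlowup_of_adicCompletion_atPrime 𝔮 I hI hI𝔮 hoff⟩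

end Summit.ResolutionOfSingularities.ResolutionOfSingularities.Theorems.FRationalResolution.BlowupRegularCompletionAscent

end
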